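import Literature.NumberTheory.EllipticCurves.Sprung2012.SharpFlatSelmer
import Literature.NumberTheory.EllipticCurves.Sprung2024.ChromaticRankZeroOneSided
import Literature.NumberTheory.EllipticCurves.PAdicBSD
import HarnessLib

/-!
# Sprung 2024, §5.2: the ♯/♭ Selmer groups are cotorsion when `L(E,1) ≠ 0`, and the ♯/♭
# `Γ`-Euler characteristic `f^⋆(0) ∼ #Sel_{p^∞}(E/ℚ) · ∏_l c_l^{(p)}` (Lemmas 5.5, 5.8, 5.9) — named
# facts on the REAL objects `X^⋆(E/ℚ_∞)` of `Sprung2012/SharpFlatSelmer.lean`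

Topic `Literature/NumberTheory/EllipticCurves`, cluster `Sprung2024`. Source (version of record):
F. Ito Sprung, *On Iwasawa main conjectures for elliptic curves at supersingular primes: beyond the
case `a_p = 0`*, Adv. Math. **449** (2024) 109741 [Sprung2024] (publisher PDF at the NSF Public
Access Repository, purl 10611567, store `paper:url-4cf1d13002d7`; locators `p. NN` = journal page).
This file is the `X^{♯/♭}`-side companion of `Sprung2024/ChromaticRankZeroOneSided.lean` (which
vendors the Λ-free Cor. 1.2 (ii)); it is the ♯/♭ twin of `BDKim2013/SignedCharValueRankZero.lean`
(B. D. Kim's `±` Euler characteristic on `Kobayashi2003.SignedSelmerDualData`) and supplies the body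
of the cell's displayed binder "(K•)" (ledger cite item `wi-68275`, BLOCKED until now on
`decl-missing:SharpFlatSelmerDualData`). TWO published statements vendored as NAMED FACTS
(`def … : Prop`, nothing asserted, no `_holds`; D-0014); HONEST FRAMING (cell `bsd-ssimc`, seat
`bsd-ssimc-k3c5-kdot-split`, crux stmt-BirchSwinnertonDyer-19003 `SprungLowerHalfAtThree`): net debt
+2; nothing about any curve is asserted; no census cell moves; BSD is not proved by any of this.

## The printed statements (§5.2, pp. 39–41), verbatim

Standing assumptions of §5.2 (Thm. 5.3, p. 38): "Let `E` be an elliptic curve with square-free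
conductor `N` with supersingular reduction at `p ≠ 2`. Assume that `L(E, 1) ≠ 0` and assume also
Conjecture 3.33 holds." — Conjecture 3.33 is used ONLY in the final "Proof of Theorem 5.3" (through
the main conjecture, Thm. 1.1); the statements below do not use it. p. 39: "In view of the first
assumption [`L(E,1) ≠ 0`], the ♯ and ♭ Selmer groups from [64, Definition 7.11] are both finitely
generated cotorsion `ℤ_p[[X]]`-modules, cf. [64, Theorem 7.14]. We thus are not confined to a
particular choice … and let `⋆` denote either ♯ or ♭ in this final subsection. We now define `Col♯_p`
and `Col♭_p` to be the component of the trivial tame character of the maps appearing in [64,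
Definition 7.1] … We denote by `E^♯_{∞,p}` (resp. `E^♭_{∞,p}`) the exact annihilator of `ker Col♯_p`
(resp. `ker Col♭_p`) under the local Tate pairing, cf. [64, Definition 7.9]." Remark 5.4: "Since the
analytic rank is `0`, we have that `L♯(0) ≠ 0 ≠ L♭(0)`, and `X♯` and `X♭` are both `Λ`-torsion, by
[64, Theorem 7.14]". **Lemma 5.5** (p. 40): "Denote by `E(ℚ)_p` the `p`-primary torsion points of
`E(ℚ)`. Also denote by `c_l^{(p)}` the `p`-component of the Tamagawa number `c_l` … Assume
`(Sel⋆(E, ℚ_∞))_{Gal(ℚ_∞/ℚ)}` is finite. We then have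
`1/|(Sel⋆(E, ℚ_∞))_{Gal(ℚ_∞/ℚ)}| = (∏_{l bad} c_l^{(p)} / #E(ℚ)_p) × 1/|ker g|`." **Lemma 5.7**:
"`Sel⋆(E, ℚ_∞)^{Gal(ℚ_∞/ℚ)}` is finite if `L(E, 1) ≠ 0`." **Lemma 5.8** (p. 41):
"`|Sel⋆(E, ℚ_∞)^{Gal(ℚ_∞/ℚ)}| = (|Sel(E, ℚ)| / #E(ℚ)_p) × |ker g|`." **Lemma 5.9**: "Let `f⋆` be a
generator of the characteristic ideal of `X⋆` and assume that `Sel⋆(E, ℚ_∞)^{Gal(ℚ_∞/ℚ)}` is finite.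
Then `|f(0)|_p = |Sel⋆(E, ℚ_∞)^{Gal(ℚ_∞/ℚ)}| / |(Sel⋆(E, ℚ_∞))_{Gal(ℚ_∞/ℚ)}|`" [Greenberg, LNM 1716,
Lemma 4.2: `f(0) ∼ #S^Γ/#S_Γ` up to a `p`-adic unit]. "Proof of Theorem 5.3. The theorem now follows
using Lemma 5.9 and multiplying the terms in Lemma 5.8 and Lemma 5.5, and noting that since `E[p]` is
irreducible as a Galois representation, we necessarily have `|E(ℚ)_p| = 1`." (p. 41). Here `Sel(E,ℚ)`
is the `p^∞`-Selmer group (`X_0 := Hom(Sel(E,ℚ), ℚ_p/ℤ_p)` "being finite is automatic by our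
assumption", proof of Lemma 5.7).

## Transcription

Setting = `Sprung2012.thm22_exists_isHondaSystem`'s (`W/ℚ` elliptic, globally minimal for the
Tamagawa numbers; `p ≠ 2`, good reduction, `p ∣ a_p`; cyclotomic `(κ, γ)` with
`IsCyclotomicVariable p γ`; the place `v ∣ p`, a local lift `g`, a Honda system `(cneg, c)`) plus the
printed `N` square-free (`W.IsSemistable (𝓞 ℚ)`) and `L(E,1) ≠ 0` (`W.entireLFunction 1 ≠ 0`);
`X⋆ = ` any `D : Sprung2012.SharpFlatSelmerDualData …`; "`(f⋆)` = the characteristic ideal" =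
`D.charIdeal = Ideal.span {f}`; `Sel(E,ℚ)` = `W.selmerGroupPInfty p`; `∏ c_l^{(p)}` =
`p^{ord_p(W.tamagawaProduct)}`; "`∼`, `|·|_p`" spelled as `f(0) = u · p^{ord_p ∏_l c_l} · #Sel_{p^∞}(E/ℚ)`
in `ℚ_p` with `u ∈ ℤ_pˣ` — the torsion factor `#E(ℚ)_p²` omitted as in the printed final step
(`|E(ℚ)_p| = 1`: `E[p]` is irreducible at a supersingular `p`, cf.
`Sprung2024.padicValNat_torsionOrder_eq_zero_of_supersingular`) — EXACTLY the body of the cell's binder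
`Supersingular.SignedDatum.EulerCharacteristic` and of `BDKim2013.cor315_signedCharValue_rankZero`.
As there, the finiteness of `Sel_{p^∞}(E/ℚ)` (which the printed proof DERIVES from `L(E,1) ≠ 0`,
Kato) and the cotorsion of `X⋆` are displayed as hypotheses of the Euler-characteristic fact (a
weakening); the cotorsion is vendored separately as `sec52_sharpFlatSelmerDual_finite_torsion`.

FLAG for the referee: `Sprung24-§5.2-via-Greenberg` — the printed proofs of Lemmas 5.5–5.9 are by
reference ("the proof of [18, Lemma 4.7] with Sel replaced with Sel⋆", "[17, Lemma 4.3]", "[18,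
Lemma 4.2]"; [17], [18] = Greenberg), with the one new ingredient `r_p` injective (Lemma 5.5,
proved on p. 40 by the snake lemma on `(ker Col⋆_p)_X → ker Col⋆_{p,0}`).

## References
* [Sprung2024] Thm. 5.3 (p. 38); §5.2: p. 39 (first paragraph), Remark 5.4, Lemma 5.5 (p. 40),
  Lemmas 5.6–5.9 and Proof of Thm. 5.3 (p. 41).
* [Sprung2012] F. Sprung, J. Number Theory 132 (2012): Def. 7.1, 7.2, 7.9, 7.11, Thm. 7.14.
* [GreenbergLNM1716] R. Greenberg, LNM 1716 (1999), Lemmas 3.3, 4.2, 4.3, 4.7.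
* [BDKim2013] B. D. Kim, J. Aust. Math. Soc. 95 (2013), Cor. 3.15 (the `a_p = 0` twin).
-/

noncomputable section

open scoped Classical NumberField

open NumberField IsDedekindDomain WeierstrassCurve Literature.NumberTheory.EllipticCurves
  Literature.NumberTheory.EllipticCurves.ZpExtension Literature.NumberTheory.EllipticCurves.Sprung2017
  Literature.NumberTheory.EllipticCurves.Sprung2012

namespace Literature.NumberTheory.EllipticCurves.Sprung2024

/-- **Sprung 2024, §5.2 (p. 39, first paragraph, and Remark 5.4), citing [64, Thm. 7.14]: at
analytic rank `0` both `X^♯(E/ℚ_∞)` and `X^♭(E/ℚ_∞)` are finitely generated torsion `Λ`-modules.**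
Printed: "In view of the first assumption [`L(E,1) ≠ 0`], the ♯ and ♭ Selmer groups from [64,
Definition 7.11] are both finitely generated cotorsion `ℤ_p[[X]]`-modules, cf. [64, Theorem 7.14]";
"Since the analytic rank is `0`, we have that `L♯(0) ≠ 0 ≠ L♭(0)`, and `X♯` and `X♭` are both
`Λ`-torsion, by [64, Theorem 7.14]". Here, under §5.2's standing hypotheses (`N` square-free,
`p ≠ 2` of good supersingular reduction, `L(E,1) ≠ 0`) and in the setting of
`Sprung2012.thm22_exists_isHondaSystem` (cyclotomic `(κ, γ)`, place `v ∣ p`, local lift `g`, Honda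
system `(cneg, c)`): for either colour and every dual datum `D`, `D.X` is `Module.Finite` and
`Module.IsTorsion` over `Λ`. Nothing is asserted; no `_holds` is expected.
[cite: Sprung2024, §5.2 p. 39 (first paragraph) and Remark 5.4] [cite: Sprung2012, Thm. 7.14 (p. 1504)] -/
def sec52_sharpFlatSelmerDual_finite_torsion : Prop :=
  ∀ (W : WeierstrassCurve ℚ) [W.IsElliptic] [W.IsGloballyMinimal] (p : ℕ) [Fact p.Prime],
    p ≠ 2 → W.IsSemistable (𝓞 ℚ) → W.HasGoodReductionAtPrime p → (p : ℤ) ∣ W.frobeniusTrace p →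
    W.entireLFunction 1 ≠ 0 →
    ∀ (κ : ZpExtension ℚ p) (γ : Field.absoluteGaloisGroup ℚ),
      κ.IsCyclotomic → κ.IsTopGenerator γ → IsCyclotomicVariable p γ →
    ∀ (v : HeightOneSpectrum (𝓞 ℚ)), (p : 𝓞 ℚ) ∈ v.asIdeal →
    ∀ (g : Field.absoluteGaloisGroup (v.adicCompletion ℚ)),
      κ.IsTopGenerator (resGalOfEmb (closureEmb (K := ℚ) (v.adicCompletion ℚ)) g) →
    ∀ (cneg : localPoints W (v.adicCompletion ℚ)) (c : ℕ → localPoints W (v.adicCompletion ℚ)),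
      IsHondaSystem κ (closureEmb (K := ℚ) (v.adicCompletion ℚ)) W (W.frobeniusTrace p) g cneg c →
    ∀ (col : Chroma)
      (D : SharpFlatSelmerDualData W κ γ (closureEmb (K := ℚ) (v.adicCompletion ℚ))
        (W.frobeniusTrace p) g c col),
      Module.Finite (IwasawaAlgebra p) D.X ∧ Module.IsTorsion (IwasawaAlgebra p) D.X

/-- **Sprung 2024, §5.2, Lemmas 5.5 · 5.8 · 5.9 multiplied (as in the printed "Proof of Theorem 5.3",
p. 41): the ♯/♭ `Γ`-Euler characteristic in analytic rank `0`,
`f^⋆(0) ∼ #Sel_{p^∞}(E/ℚ) · ∏_l c_l^{(p)} / #E(ℚ)_p²` with `#E(ℚ)_p = 1`.** Printed: Lemma 5.5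
"`1/|(Sel⋆(E,ℚ_∞))_Γ| = (∏_{l bad} c_l^{(p)} / #E(ℚ)_p) × 1/|ker g|`", Lemma 5.8
"`|Sel⋆(E,ℚ_∞)^Γ| = (|Sel(E,ℚ)| / #E(ℚ)_p) × |ker g|`", Lemma 5.9 "Let `f⋆` be a generator of the
characteristic ideal of `X⋆` … `|f(0)|_p = |Sel⋆(E,ℚ_∞)^Γ| / |(Sel⋆(E,ℚ_∞))_Γ|`" [equality up to a
`p`-adic unit, Greenberg Lemma 4.2], and "noting that since `E[p]` is irreducible … `|E(ℚ)_p| = 1`".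
Here, under §5.2's standing hypotheses (`N` square-free, `p ≠ 2` good supersingular, `L(E,1) ≠ 0`)
and in the setting of `Sprung2012.thm22_exists_isHondaSystem`: for either colour `⋆`, any dual datum
`D` of `Sel^⋆(E/ℚ_∞)` that is finitely generated torsion over `Λ` (displayed;
`sec52_sharpFlatSelmerDual_finite_torsion`), any generator `f` of `char(X^⋆)`, and `Sel_{p^∞}(E/ℚ)`
finite (displayed; in print from `L(E,1) ≠ 0`): `f(0) = u · p^{ord_p(∏_l c_l)} · #Sel_{p^∞}(E/ℚ)` for
some `u ∈ ℤ_pˣ` — the body of `BDKim2013.cor315_signedCharValue_rankZero` / of the cell's binder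
`SignedDatum.EulerCharacteristic`. Flag `Sprung24-§5.2-via-Greenberg` (module docstring). Nothing is
asserted; no `_holds` is expected. TODO(general form): the torsion factor `#E(ℚ)_p²` as printed in
Lemmas 5.5/5.8 (equal to `1` here). [cite: Sprung2024, §5.2 Lemmas 5.5, 5.8, 5.9 and Proof of Thm. 5.3 (pp. 40–41)] -/
def lem59_sharpFlatCharValue_rankZero : Prop :=
  ∀ (W : WeierstrassCurve ℚ) [W.IsElliptic] [W.IsGloballyMinimal] (p : ℕ) [Fact p.Prime],
    p ≠ 2 → W.IsSemistable (𝓞 ℚ) → W.HasGoodReductionAtPrime p → (p : ℤ) ∣ W.frobeniusTrace p →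
    W.entireLFunction 1 ≠ 0 →
    ∀ (κ : ZpExtension ℚ p) (γ : Field.absoluteGaloisGroup ℚ),
      κ.IsCyclotomic → κ.IsTopGenerator γ → IsCyclotomicVariable p γ →
    ∀ (v : HeightOneSpectrum (𝓞 ℚ)), (p : 𝓞 ℚ) ∈ v.asIdeal →
    ∀ (g : Field.absoluteGaloisGroup (v.adicCompletion ℚ)),
      κ.IsTopGenerator (resGalOfEmb (closureEmb (K := ℚ) (v.adicCompletion ℚ)) g) →
    ∀ (cneg : localPoints W (v.adicCompletion ℚ)) (c : ℕ → localPoints W (v.adicCompletion ℚ)),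
      IsHondaSystem κ (closureEmb (K := ℚ) (v.adicCompletion ℚ)) W (W.frobeniusTrace p) g cneg c →
    ∀ (col : Chroma)
      (D : SharpFlatSelmerDualData W κ γ (closureEmb (K := ℚ) (v.adicCompletion ℚ))
        (W.frobeniusTrace p) g c col) [Module.Finite (IwasawaAlgebra p) D.X],
      Module.IsTorsion (IwasawaAlgebra p) D.X →
    ∀ (f : IwasawaAlgebra p), D.charIdeal = Ideal.span {f} →
      Finite (W.selmerGroupPInfty p) →
      ∃ u : ℤ_[p]ˣ,
        ((PowerSeries.constantCoeff f : ℤ_[p]) : ℚ_[p]) =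
          ((u : ℤ_[p]) : ℚ_[p]) * (p : ℚ_[p]) ^ (padicValNat p W.tamagawaProduct) *
            (Nat.card (W.selmerGroupPInfty p) : ℚ_[p])

end Literature.NumberTheory.EllipticCurves.Sprung2024

end
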